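import Literature.Analysis.FunctionSpaces.BesselIGeneratingFunction
import HarnessLib

/-!
# Neumann's addition theorem for modified Bessel functions of integer order: `I_n(x + y) = Σ_{k∈ℤ} I_{n+k}(x) I_k(y)`

Topic `Literature/Analysis/FunctionSpaces`, a proofs sibling of `BesselIGeneratingFunction.lean` (the tree's
`e^{x cos θ} = Σ_{m∈ℤ} I_{|m|}(x) e^{imθ}`, absolutely convergent; DLMF 10.35) and `BesselMoments.lean`
(`besselI n x = π⁻¹ ∫₀^π e^{x cos θ} cos(nθ) dθ`, DLMF 10.32.3).  This file proves, for INTEGER orders and ALL real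
arguments, NEUMANN'S ADDITION THEOREM (DLMF 10.44.2 with `𝒵 = I`, `ν = n ∈ ℤ`, upper signs):
`I_{|n|}(x + y) = Σ_{k∈ℤ} I_{|n+k|}(x) I_{|k|}(y)` — the convolution (semigroup) law of the symmetric kernel
`k ↦ I_{|k|}`, and its diagonal cases `Σ_k I_{|k|}(x)² = I₀(2x)`, `Σ_k I_{|k|}(x) I_{|k+n|}(x) = I_{|n|}(2x)`.
Method: the Fourier coefficients of `e^{x cos θ}` on `(−π, π]` are `2π I_{|m|}(x)` (term-wise integration of the
generating function), and `e^{(x+y) cos θ} = e^{x cos θ} e^{y cos θ}` is integrated against `e^{inθ}` term by term.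
Everything is proved; no definition and no named fact.

* `hasSum_besselI_natAbs_mul_besselI_natAbs_add` — `HasSum (k ↦ I_{|k|}(y) I_{|n+k|}(x)) (I_{|n|}(x + y))`;
* `besselI_natAbs_add_eq_tsum` — `I_{|n|}(x + y) = Σ'_k I_{|k|}(y) I_{|n+k|}(x)`;
* `hasSum_besselI_natAbs_mul_besselI_natAbs_sub` — the convolution form `HasSum (k ↦ I_{|k|}(x) I_{|n−k|}(y)) (I_{|n|}(x+y))`;
* `hasSum_besselI_natAbs_sq` — `Σ_k I_{|k|}(x)² = I₀(2x)`; `hasSum_besselI_natAbs_mul_shift` — `Σ_k I_{|k|}(x) I_{|n+k|}(x) = I_{|n|}(2x)`.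

## References

* NIST DLMF §10.44.2 (Neumann's addition theorem for modified Bessel functions), §10.35 (generating function),
  §10.32.3. [`DLMF`]
-/

noncomputable section

open Real MeasureTheory Set Complex

namespace Literature.Analysis.FunctionSpaces

/-! ### 1. Fourier coefficients of `e^{x cos θ}` on `(−π, π]` -/

/-- `∫_{(−π,π]} e^{imθ} dθ = 2π` if `m = 0`, `0` otherwise (orthogonality of characters; private copy of
`WeylIntegrationVandermonde.integral_Ioc_cexp_int_mul` to keep the import graph inside `Analysis`). [folklore] -/
private theorem integral_Ioc_cexp_int_mul' (m : ℤ) :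
    ∫ θ in Set.Ioc (-π) π, cexp ((m : ℂ) * θ * I) = if m = 0 then (2 * π : ℂ) else 0 := by
  split_ifs with hm
  · subst hm
    simp only [Int.cast_zero, zero_mul, Complex.exp_zero, setIntegral_const, measureReal_def, Real.volume_Ioc,
      sub_neg_eq_add]
    rw [ENNReal.toReal_ofReal (by positivity)]
    simp [two_mul]
  · rw [← intervalIntegral.integral_of_le (by linarith [Real.pi_pos] : -π ≤ π)]
    have hc : (m : ℂ) * I ≠ 0 := mul_ne_zero (Int.cast_ne_zero.2 hm) I_ne_zero
    have h := integral_exp_mul_complex (a := -π) (b := π) hc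
    simp_rw [show ∀ θ : ℝ, (m : ℂ) * θ * I = m * I * θ from fun θ => by ring]
    rw [h]
    have h2 : cexp (m * I * (π : ℝ)) = cexp (m * I * ((-π : ℝ) : ℂ)) := by
      rw [show (m : ℂ) * I * (π : ℝ) = m * I * ((-π : ℝ) : ℂ) + m * (2 * π * I) by push_cast; ring, Complex.exp_add,
        Complex.exp_int_mul_two_pi_mul_I, mul_one]
    rw [h2, sub_self, zero_div]

/-- **`∫_{(−π,π]} e^{x cos θ} e^{imθ} dθ = 2π I_{|m|}(x)`** (`m ∈ ℤ`, `x ∈ ℝ`): the Fourier coefficients of the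
generating function, by term-wise integration of `e^{x cos θ} = Σ_k I_{|k|}(x) e^{ikθ}`. [cite: DLMF, 10.35.2] -/
theorem integral_Ioc_cexp_cos_mul_cexp_int_mul (x : ℝ) (m : ℤ) :
    ∫ θ in Set.Ioc (-π) π, cexp ((x : ℂ) * Real.cos θ) * cexp ((m : ℂ) * θ * I)
      = 2 * π * (besselI m.natAbs x : ℂ) := by
  set F : ℤ → ℝ → ℂ := fun k θ => (besselI k.natAbs x : ℂ) * cexp (((k + m : ℤ) : ℂ) * θ * I) with hF
  have hFeq : ∀ θ : ℝ, cexp ((x : ℂ) * Real.cos θ) * cexp ((m : ℂ) * θ * I) = ∑' k, F k θ := by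
    intro θ
    rw [← (hasSum_besselI_natAbs_mul_cexp x θ).tsum_eq, ← tsum_mul_right]
    refine tsum_congr fun k => ?_
    simp only [hF]
    rw [mul_assoc, ← Complex.exp_add]
    congr 2
    push_cast
    ring
  have hFnorm : ∀ k θ, ‖F k θ‖ = besselI k.natAbs |x| := by
    intro k θ
    simp only [hF]
    rw [norm_mul, show (((k + m : ℤ) : ℂ)) * (θ : ℂ) * I = ((((k + m : ℤ) : ℝ) * θ : ℝ) : ℂ) * I by
      push_cast; ring, Complex.norm_exp_ofReal_mul_I, mul_one, Complex.norm_real, Real.norm_eq_abs,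
      abs_besselI_eq_besselI_abs]
  have hFint : ∀ k, Integrable (F k) (volume.restrict (Set.Ioc (-π) π)) := by
    intro k
    refine Integrable.mono' (integrable_const (besselI k.natAbs |x|)) ?_
      (Filter.Eventually.of_forall fun θ => (hFnorm k θ).le)
    exact (Continuous.aestronglyMeasurable (by simp only [hF]; fun_prop))
  have hFsum : Summable fun k => ∫ θ in Set.Ioc (-π) π, ‖F k θ‖ := by
    simp_rw [hFnorm, MeasureTheory.setIntegral_const]
    exact (summable_besselI_natAbs |x|).mul_left _
  calc ∫ θ in Set.Ioc (-π) π, cexp ((x : ℂ) * Real.cos θ) * cexp ((m : ℂ) * θ * I)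
      = ∫ θ in Set.Ioc (-π) π, ∑' k, F k θ := setIntegral_congr_fun measurableSet_Ioc fun θ _ => hFeq θ
    _ = ∑' k, ∫ θ in Set.Ioc (-π) π, F k θ := (integral_tsum_of_summable_integral_norm hFint hFsum).symm
    _ = ∑' k : ℤ, (besselI k.natAbs x : ℂ) * (if k + m = 0 then (2 * π : ℂ) else 0) := by
        refine tsum_congr fun k => ?_
        simp only [hF]
        rw [integral_const_mul, integral_Ioc_cexp_int_mul']
    _ = (besselI (-m).natAbs x : ℂ) * (2 * π) := by
        rw [tsum_eq_single (-m)]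
        · simp
        · intro k hk
          rw [if_neg (fun h => hk (by omega)), mul_zero]
    _ = 2 * π * (besselI m.natAbs x : ℂ) := by rw [Int.natAbs_neg, mul_comm]

/-! ### 2. Neumann's addition theorem -/

/-- **NEUMANN'S ADDITION THEOREM, integer order**: `Σ_{k∈ℤ} I_{|k|}(y) I_{|n+k|}(x) = I_{|n|}(x + y)` for all real
`x, y` and every integer `n` (absolutely convergent). [cite: DLMF, 10.44.2] -/
theorem hasSum_besselI_natAbs_mul_besselI_natAbs_add (x y : ℝ) (n : ℤ) :
    HasSum (fun k : ℤ => besselI k.natAbs y * besselI (n + k).natAbs x) (besselI n.natAbs (x + y)) := by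
  -- summability of the real family: `|I_{|k|}(y) I_{|n+k|}(x)| ≤ I_{|k|}(|y|) e^{|x|}`
  have hbd : ∀ j : ℤ, |besselI j.natAbs x| ≤ Real.exp |x| := fun j => by
    rw [abs_besselI_eq_besselI_abs]
    exact le_hasSum (hasSum_besselI_natAbs |x|) j fun _ _ => besselI_nonneg _ (abs_nonneg x)
  have hsum : Summable fun k : ℤ => besselI k.natAbs y * besselI (n + k).natAbs x := by
    refine Summable.of_norm_bounded ((summable_besselI_natAbs |y|).mul_right (Real.exp |x|)) fun k => ?_
    rw [Real.norm_eq_abs, abs_mul, abs_besselI_eq_besselI_abs]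
    exact mul_le_mul_of_nonneg_left (hbd _) (besselI_nonneg _ (abs_nonneg y))
  -- the terms `G k θ = I_{|k|}(y) e^{ikθ} · e^{x cos θ} e^{inθ}` and their sum `e^{(x+y) cos θ} e^{inθ}`
  set G : ℤ → ℝ → ℂ := fun k θ => (besselI k.natAbs y : ℂ) * cexp ((k : ℂ) * θ * I) *
    (cexp ((x : ℂ) * Real.cos θ) * cexp ((n : ℂ) * θ * I)) with hG
  have hGeq : ∀ θ : ℝ, cexp (((x + y : ℝ) : ℂ) * Real.cos θ) * cexp ((n : ℂ) * θ * I) = ∑' k, G k θ := by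
    intro θ
    have h := ((hasSum_besselI_natAbs_mul_cexp y θ).mul_right
      (cexp ((x : ℂ) * Real.cos θ) * cexp ((n : ℂ) * θ * I))).tsum_eq
    have e1 : cexp (((x + y : ℝ) : ℂ) * Real.cos θ) = cexp ((y : ℂ) * Real.cos θ) * cexp ((x : ℂ) * Real.cos θ) := by
      rw [← Complex.exp_add]; congr 1; push_cast; ring
    simp only [hG]
    rw [h, e1, mul_assoc]
  have hGnorm : ∀ k θ, ‖G k θ‖ = besselI k.natAbs |y| * Real.exp (x * Real.cos θ) := by
    intro k θ
    simp only [hG]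
    rw [norm_mul, norm_mul, norm_mul, show (k : ℂ) * (θ : ℂ) * I = (((k : ℝ) * θ : ℝ) : ℂ) * I by push_cast; ring,
      show (n : ℂ) * (θ : ℂ) * I = (((n : ℝ) * θ : ℝ) : ℂ) * I by push_cast; ring,
      Complex.norm_exp_ofReal_mul_I, Complex.norm_exp_ofReal_mul_I, mul_one, mul_one, Complex.norm_real,
      Real.norm_eq_abs, abs_besselI_eq_besselI_abs, show (x : ℂ) * (Real.cos θ : ℂ) = ((x * Real.cos θ : ℝ) : ℂ) by
        push_cast; ring, Complex.norm_exp_ofReal]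
  have hGint : ∀ k, Integrable (G k) (volume.restrict (Set.Ioc (-π) π)) := by
    intro k
    refine Integrable.mono' (integrable_const (besselI k.natAbs |y| * Real.exp |x|)) ?_
      (Filter.Eventually.of_forall fun θ => ?_)
    · exact (Continuous.aestronglyMeasurable (by simp only [hG]; fun_prop))
    · show ‖G k θ‖ ≤ _
      rw [hGnorm]
      refine mul_le_mul_of_nonneg_left (Real.exp_le_exp.2 ?_) (besselI_nonneg _ (abs_nonneg y))
      exact (le_abs_self _).trans (by rw [abs_mul]; exact mul_le_of_le_one_right (abs_nonneg x) (Real.abs_cos_le_one θ))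
  have hGsum : Summable fun k => ∫ θ in Set.Ioc (-π) π, ‖G k θ‖ := by
    refine Summable.of_nonneg_of_le (fun k => integral_nonneg fun θ => norm_nonneg _)
      (fun k => ?_) (((summable_besselI_natAbs |y|).mul_right (Real.exp |x| * (2 * π))))
    have hle : ∫ θ in Set.Ioc (-π) π, ‖G k θ‖ ≤ ∫ θ in Set.Ioc (-π) π, besselI k.natAbs |y| * Real.exp |x| := by
      refine integral_mono_of_nonneg (Filter.Eventually.of_forall fun θ => norm_nonneg _)
        (integrable_const _) (Filter.Eventually.of_forall fun θ => ?_)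
      show ‖G k θ‖ ≤ _
      rw [hGnorm]
      refine mul_le_mul_of_nonneg_left (Real.exp_le_exp.2 ?_) (besselI_nonneg _ (abs_nonneg y))
      exact (le_abs_self _).trans (by rw [abs_mul]; exact mul_le_of_le_one_right (abs_nonneg x) (Real.abs_cos_le_one θ))
    refine hle.trans (le_of_eq ?_)
    rw [setIntegral_const, measureReal_def, Real.volume_Ioc, ENNReal.toReal_ofReal (by linarith [Real.pi_pos])]
    simp only [smul_eq_mul]
    ring
  -- integrate term by term
  have hmain : (2 * π * (besselI n.natAbs (x + y) : ℂ))
      = ∑' k : ℤ, ((besselI k.natAbs y * besselI (n + k).natAbs x : ℝ) : ℂ) * (2 * π) := by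
    calc (2 * π * (besselI n.natAbs (x + y) : ℂ))
        = ∫ θ in Set.Ioc (-π) π, cexp (((x + y : ℝ) : ℂ) * Real.cos θ) * cexp ((n : ℂ) * θ * I) :=
          (integral_Ioc_cexp_cos_mul_cexp_int_mul (x + y) n).symm
      _ = ∫ θ in Set.Ioc (-π) π, ∑' k, G k θ := setIntegral_congr_fun measurableSet_Ioc fun θ _ => hGeq θ
      _ = ∑' k, ∫ θ in Set.Ioc (-π) π, G k θ := (integral_tsum_of_summable_integral_norm hGint hGsum).symm
      _ = ∑' k : ℤ, ((besselI k.natAbs y * besselI (n + k).natAbs x : ℝ) : ℂ) * (2 * π) := by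
          refine tsum_congr fun k => ?_
          have hpt : ∀ θ : ℝ, G k θ = (besselI k.natAbs y : ℂ) *
              (cexp ((x : ℂ) * Real.cos θ) * cexp ((((n + k : ℤ) : ℂ)) * θ * I)) := by
            intro θ
            simp only [hG]
            rw [show (((n + k : ℤ) : ℂ)) * θ * I = (k : ℂ) * θ * I + (n : ℂ) * θ * I by push_cast; ring,
              Complex.exp_add]
            ring
          simp_rw [hpt]
          rw [integral_const_mul, integral_Ioc_cexp_cos_mul_cexp_int_mul]
          push_cast
          ring
  -- back to `ℝ`
  have hC : HasSum (fun k : ℤ => ((besselI k.natAbs y * besselI (n + k).natAbs x : ℝ) : ℂ))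
      (besselI n.natAbs (x + y) : ℂ) := by
    have hs : Summable fun k : ℤ => ((besselI k.natAbs y * besselI (n + k).natAbs x : ℝ) : ℂ) :=
      (Complex.ofRealCLM.summable hsum)
    have h2π : (2 * π : ℂ) ≠ 0 := by exact_mod_cast (by positivity : (2 * π : ℝ) ≠ 0)
    have heq : ∑' k : ℤ, ((besselI k.natAbs y * besselI (n + k).natAbs x : ℝ) : ℂ) = (besselI n.natAbs (x + y) : ℂ) := by
      have := hmain
      rw [tsum_mul_right] at this
      exact mul_right_cancel₀ h2π (by rw [← this]; ring)
    rw [← heq]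
    exact hs.hasSum
  exact_mod_cast (Complex.hasSum_ofReal.1 (by simpa using hC))

/-- `I_{|n|}(x + y) = Σ'_{k∈ℤ} I_{|k|}(y) I_{|n+k|}(x)`. [cite: DLMF, 10.44.2] -/
theorem besselI_natAbs_add_eq_tsum (x y : ℝ) (n : ℤ) :
    besselI n.natAbs (x + y) = ∑' k : ℤ, besselI k.natAbs y * besselI (n + k).natAbs x :=
  (hasSum_besselI_natAbs_mul_besselI_natAbs_add x y n).tsum_eq.symm

/-- **The convolution form**: `Σ_{k∈ℤ} I_{|k|}(x) I_{|n−k|}(y) = I_{|n|}(x + y)`. [cite: DLMF, 10.44.2] -/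
theorem hasSum_besselI_natAbs_mul_besselI_natAbs_sub (x y : ℝ) (n : ℤ) :
    HasSum (fun k : ℤ => besselI k.natAbs x * besselI (n - k).natAbs y) (besselI n.natAbs (x + y)) := by
  have h := hasSum_besselI_natAbs_mul_besselI_natAbs_add y x n
  rw [add_comm y x] at h
  have h2 : HasSum ((fun k : ℤ => besselI k.natAbs x * besselI (n + k).natAbs y) ∘ (Equiv.neg ℤ))
      (besselI n.natAbs (x + y)) := (Equiv.neg ℤ).hasSum_iff.2 h
  refine h2.congr_fun fun k => ?_
  simp only [Function.comp_apply, Equiv.neg_apply, Int.natAbs_neg, sub_eq_add_neg]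

/-- **`Σ_{k∈ℤ} I_{|k|}(x) I_{|n+k|}(x) = I_{|n|}(2x)`**. [cite: DLMF, 10.44.2] -/
theorem hasSum_besselI_natAbs_mul_shift (x : ℝ) (n : ℤ) :
    HasSum (fun k : ℤ => besselI k.natAbs x * besselI (n + k).natAbs x) (besselI n.natAbs (2 * x)) := by
  simpa [two_mul] using hasSum_besselI_natAbs_mul_besselI_natAbs_add x x n

/-- **`Σ_{k∈ℤ} I_{|k|}(x)² = I₀(2x)`**. [cite: DLMF, 10.44.2] -/
theorem hasSum_besselI_natAbs_sq (x : ℝ) : HasSum (fun k : ℤ => besselI k.natAbs x ^ 2) (besselI 0 (2 * x)) := by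
  have h := hasSum_besselI_natAbs_mul_shift x 0
  simp only [zero_add, Int.natAbs_zero] at h
  refine h.congr_fun fun k => ?_
  ring

end Literature.Analysis.FunctionSpaces
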